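import Mathlib
import Literature.Computability.Complexity.Classes
import Literature.Computability.Complexity.Nondeterministic
import Literature.Computability.Complexity.Randomized
import Literature.Computability.Complexity.ProbabilisticClasses
import Literature.Computability.Complexity.Oracle
import Literature.Computability.Complexity.OracleClosure
import Literature.Computability.Complexity.OracleProofs
import Literature.Computability.Complexity.CNF
import Literature.Computability.MetaComplexity.ChenJinSanthanamWilliams2022.PNPStreamingRefuterMagnification
import HarnessLib

/-!
# Chen–Jin–Santhanam–Williams (FOCS 2021), Theorem 1.3 — second typing of the PAY-OFF over
# D14′ `EXPRelPoly O` (= `EXP^O` with a polynomial-time STEP and an exponential ROUND budget)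
# (magnification-gap census row R65; referee F40′ / GAPS W-A11d-1, option (b))

Companion of `PNPStreamingRefuterMagnification.lean` (row R65, `thm13` over D14 `EXPRel`/`EXPNP`),
whose HYPOTHESIS side (`PolylogSpaceStreaming f`, `HasPNPStreamRefuter L A`) is reused here
LITERALLY; only the relativised exponential-time class in the CONCLUSION is re-typed. Nothing in
the companion file is touched. Bib key `ChenEtAl2022`; locators are to the held LaTeX-source text
`paper:arxiv-2203.14379`.

* Thm. 1.3 (p0005 L14): "Let `f(n) ≥ ω(1)`. For every language `L ∈ NP`, a `P^NP`-constructive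
  separation of `L` from uniform randomized streaming algorithms with `O(n · (log n)^{f(n)})`
  time and `O(log n)^{f(n)}` space implies `EXP^NP ≠ BPP`."

## Why a second typing (W-A11d-1, certificate `StepBudgetInputLength.lean`)

D14 `StepExpTime M eb k` budgets ONE step machine by `2^{|x|^k+k}` steps on EVERY step-input
`(x, answers)`; since the tree's halting convention forces `|input| ≤ |output| + P · time`
(`input_length_le_of_outputsWithin`), no machine whose step outputs are bounded in `x` alone meets
it on long transcripts (`not_stepExpTime_ofFun`), and the containment `EXP^NP ⊆ EXPRel SAT` on
which the F-direction of `thm13` rests is unproved and would need a junk-query device. D14′ avoids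
the issue by construction: the step function is POLYNOMIAL-TIME IN THE STEP-INPUT LENGTH (the
tree's own `OracleAlg.IsPolyTime`, exactly as in `PRel`), and the exponential lives only in the
NUMBER OF ROUNDS and the QUERY LENGTH.

## D14′ and its adequacy (prose; the two PROVED sanity facts are `PRel_subset_EXPRelPoly`,
## `P_subset_EXPRelPoly`)

`EXPRelPoly O := {L | ∃ M, M.IsPolyTime encodingBoolBool ∧ ∃ p, ∀ x, M.run O (2^{p(|x|)}) x =
some (L x) ∧ every query of that run has length ≤ 2^{p(|x|)}}`. ADEQUACY for `EXP^O` = languages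
decided by deterministic oracle Turing machines in time `2^{poly(n)}` [Arora–Barak 2009, §3.4,
with `EXP` of §2.6], for oracles with polynomially bounded answers such as `Oracle.ofLanguage S`:
(⊆) a run makes `≤ 2^{p(n)}` rounds; before round `i` the transcript has length
`≤ n + i · (2^{p(n)} + O(1))`, so each step costs `poly(2^{p(n)})` and the whole run `2^{O(p(n))}`.
(⊇) given an oracle TM `T` running in time `2^{q(n)}`, the step function that re-simulates `T`
from the start, feeding the recorded answers to its successive queries, for `|answers| + 1`
further steps of `T` (or to its end), and then emits `T`'s pending query if `T` is at a query, a
DUMMY query (the empty word, answer ignored) if not, and `T`'s output once `T` has halted, runs in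
time polynomial in `|x| + |answers|` — it simulates at most `|answers| + 1` steps — reproduces
`T`'s computation one machine step per round, and finishes within `2^{q(n)} + 1 ≤ 2^{q(n)+1}`
rounds with queries of length `≤ 2^{q(n)}`. Unlike D14, the budget a step must meet GROWS with the
transcript it has to read, so over-long transcripts pose no obstruction. Hence, informally,
`EXPRelPoly (ofLanguage SAT) = EXP^SAT = EXP^NP`. F-direction: print's `EXP^NP ≠ BPP` gives the
typed `EXPNPPoly ≠ BPP` through `EXP^NP ⊆ EXPNPPoly` ((⊇) above, unproved in Lean but by the
routine clocked simulation, no encoding accident) and the adequacy of the tree's `BPP`; were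
`EXPNPPoly` inadvertently LARGER than `EXP^NP`, the typed conclusion would only be weaker.
[cite: ChenEtAl2022, Thm. 1.3 and §3.1] [cite: AroraBarak2009, §3.4 (oracle Turing machines)]
-/

noncomputable section

open _root_.Computability Filter

namespace Literature.Computability.Complexity

open OracleAlg

variable {β : Type}

/-- **D14′. `EXPRelPoly O = EXP^O`**, deterministic exponential time relative to the oracle `O`, in
the tree's transcript style: an oracle algorithm whose step function is polynomial-time (in the
transcript) decides `L` with oracle `O` within `2^{p(n)}` rounds, every query having length at
most `2^{p(n)}`, for some polynomial `p`.  Adequacy w.r.t. oracle Turing machines running in time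
`2^{poly(n)}`: module docstring (dummy-query padding for `⊇`).
[Arora–Barak 2009, §3.4 (oracle machines, `C^O`) with §2.6.2/Def. 2.18 ff. (`EXP`)]
[cite: AroraBarak2009, §3.4] -/
def EXPRelPoly (O : Oracle) : Set (Language Bool) :=
  {L | ∃ M : OracleAlg Bool, M.IsPolyTime encodingBoolBool ∧
    ∃ p : Polynomial ℕ, ∀ x : List Bool,
      M.run O (2 ^ p.eval x.length) x = some (L.boolIndicator x) ∧
        ∀ y ∈ M.queries O (2 ^ p.eval x.length) x, y.length ≤ 2 ^ p.eval x.length}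

/-- `EXPRelPolyClass C = EXP^C := ⋃ S ∈ C, EXP^S` (so `EXP^NP = EXPRelPolyClass NP`), matching the tree's
`PRelClass` / `NPRelClass`. [Arora–Barak 2009, §3.4 and §5.5] [cite: AroraBarak2009, §3.4] -/
def EXPRelPolyClass (C : Set (Language Bool)) : Set (Language Bool) :=
  ⋃ S ∈ C, EXPRelPoly (Oracle.ofLanguage S)

/-- Unfolding `EXPRelPoly`. [cite: AroraBarak2009, §3.4] -/
theorem mem_EXPRelPoly_iff (O : Oracle) (L : Language Bool) :
    L ∈ EXPRelPoly O ↔ ∃ M : OracleAlg Bool, M.IsPolyTime encodingBoolBool ∧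
      ∃ p : Polynomial ℕ, ∀ x : List Bool,
        M.run O (2 ^ p.eval x.length) x = some (L.boolIndicator x) ∧
          ∀ y ∈ M.queries O (2 ^ p.eval x.length) x, y.length ≤ 2 ^ p.eval x.length :=
  Iff.rfl

/-- Unfolding `EXPRelPolyClass`. [cite: AroraBarak2009, §3.4] -/
theorem mem_EXPRelPolyClass_iff (C : Set (Language Bool)) (L : Language Bool) :
    L ∈ EXPRelPolyClass C ↔ ∃ S ∈ C, L ∈ EXPRelPoly (Oracle.ofLanguage S) := by
  simp [EXPRelPolyClass]

/-- `EXP^C` is monotone in the oracle class. [folklore] -/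
theorem EXPRelPolyClass_mono {C D : Set (Language Bool)} (h : C ⊆ D) :
    EXPRelPolyClass C ⊆ EXPRelPolyClass D := by
  intro L hL
  obtain ⟨S, hS, hLS⟩ := (mem_EXPRelPolyClass_iff C L).1 hL
  exact (mem_EXPRelPolyClass_iff D L).2 ⟨S, h hS, hLS⟩

/-- **`P^O ⊆ EXP^O`**: a polynomial round/query budget `q(n)` fits within `2^{q(n)}`; more rounds
never change a produced output and a halted run asks no further queries.
[Arora–Barak 2009, §3.4] [cite: AroraBarak2009, §3.4] -/
theorem PRel_subset_EXPRelPoly (O : Oracle) : PRel O ⊆ EXPRelPoly O := by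
  rintro L ⟨M, hM, q, hq⟩
  refine ⟨M, hM, q, fun x => ?_⟩
  obtain ⟨hrun, hqs⟩ := hq x
  have hle : q.eval x.length ≤ 2 ^ q.eval x.length := Nat.lt_two_pow_self.le
  refine ⟨M.run_mono O x hle hrun, fun y hy => ?_⟩
  rw [M.queries_eq_of_run_eq_some O x hle hrun] at hy
  exact (hqs y hy).trans hle

/-- **`P^C ⊆ EXP^C`.** [Arora–Barak 2009, §3.4] [cite: AroraBarak2009, §3.4] -/
theorem PRelClass_subset_EXPRelPolyClass (C : Set (Language Bool)) :
    PRelClass C ⊆ EXPRelPolyClass C := by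
  intro L hL
  simp only [PRelClass, Set.mem_iUnion] at hL
  obtain ⟨S, hS, hLS⟩ := hL
  exact (mem_EXPRelPolyClass_iff C L).2 ⟨S, hS, PRel_subset_EXPRelPoly _ hLS⟩


/-- `P ⊆ EXPRelPoly O` for every oracle (through the tree's proved `P ⊆ P^O`,
`P_subset_PRel_holds`); in particular `EXPRelPoly O` is never empty, so no conclusion of the form
`EXPRelPoly O ≠ C` is provable by vacuity of the class. [folklore] -/
theorem P_subset_EXPRelPoly (O : Oracle) : Classes.P ⊆ EXPRelPoly O :=
  (P_subset_PRel_holds O).trans (PRel_subset_EXPRelPoly O)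

end Literature.Computability.Complexity

namespace Literature.Computability.MetaComplexity.ChenJinSanthanamWilliams2022

open Literature.Computability.Complexity Literature.Computability.Complexity.Nondeterministic
open Literature.Computability.MetaComplexity

/-- **D14′ (`EXP^NP`, second typing).** `EXPNPPoly := EXPRelPoly (Oracle.ofLanguage SAT)` —
exponential time with a `SAT` oracle, polynomial-time step and exponential round/query budget
(module docstring). [cite: AroraBarak2009, §3.4 (oracle machines; `EXP^{NP}` via a SAT oracle)] -/
def EXPNPPoly : Set (Language Bool) :=
  EXPRelPoly (Oracle.ofLanguage SAT)

/-- `P ⊆ EXPNPPoly` (PROVED; so `EXPNPPoly` is inhabited, e.g. by `∅` and by every `P`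
language). [folklore] -/
theorem P_subset_EXPNPPoly : Classes.P ⊆ EXPNPPoly :=
  P_subset_EXPRelPoly _

/-- **Chen–Jin–Santhanam–Williams, Theorem 1.3 — second typing of the pay-off** (typed, NOT
proved; typed weaker-or-equal to print given the routine adequacy `EXP^NP ⊆ EXPNPPoly` of the
module docstring). The HYPOTHESIS is LITERALLY that of `thm13` (same `PolylogSpaceStreaming f`,
same `HasPNPStreamRefuter L A`, same quantifiers); only the conclusion's class is D14′ `EXPNPPoly`
instead of D14 `EXPNP`. Print (p0005 L14): "Let `f(n) ≥ ω(1)`. For every language `L ∈ NP`, a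
`P^NP`-constructive separation of `L` from uniform randomized streaming algorithms with
`O(n · (log n)^{f(n)})` time and `O(log n)^{f(n)}` space implies `EXP^NP ≠ BPP`."
[cite: ChenEtAl2022, Thm. 1.3, p.5] -/
def thm13Poly : Prop :=
  ∀ f : ℕ → ℕ, Tendsto f atTop atTop → ∀ L ∈ NP,
    (∀ A ∈ PolylogSpaceStreaming f, HasPNPStreamRefuter L A) → EXPNPPoly ≠ BPP

/-- Modus ponens form of `thm13Poly` (the shape census X uses for its pay-off lemma).
[folklore] -/
theorem EXPNPPoly_ne_BPP_of_thm13Poly (hT : thm13Poly) {f : ℕ → ℕ} (hf : Tendsto f atTop atTop)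
    {L : Language Bool} (hL : L ∈ NP) (h : ∀ A ∈ PolylogSpaceStreaming f, HasPNPStreamRefuter L A) :
    EXPNPPoly ≠ BPP :=
  hT f hf L hL h

/-- The two typings have the SAME hypothesis: they agree as soon as the two renderings of
`EXP^NP` do (PROVED bookkeeping; the equality `EXPNPPoly = EXPNP` itself is neither claimed nor
expected to be easy — see W-A11d-1). [folklore] -/
theorem thm13Poly_iff_thm13_of_eq (h : EXPNPPoly = EXPNP) : thm13Poly ↔ thm13 := by
  unfold thm13Poly thm13
  rw [h]

end Literature.Computability.MetaComplexity.ChenJinSanthanamWilliams2022
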